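import Summits.ValiantsHypothesis.ValiantsHypothesis.Theorems.LacunarySymmetroidMatrixDescartesDoorA26WallBubblingThreePairChainDictionary
import Summits.ValiantsHypothesis.ValiantsHypothesis.Theorems.LacunarySymmetroidMatrixDescartesDoorA26WallBubblingBubblingDefs

/-!
# Wall bubbling for `DoorA26` — THREE WEYL PAIRS (value-generic): SLOT SPLITTING

HONEST FRAMING.  Bookkeeping for `ValueGenericThreePairChain26` of `Cruxes/DoorA26/Lines/wall_bubbling_ConfluentDoor.lean` (rev 7 ff.;
crux `DoorA26`, stmt-ValiantsHypothesis-19979 — OPEN, typed, never asserted); W1 seat val-sym-door-p2 g14.  The three-pair analogue of W1 g13's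
#52c `…TwoPairChainSplitA`: at a value-generic three-pair point, for each of the six class values `w` the confluent degrees spent on `w` over all
clusters sum to at most `2 = n_w − 1`, GIVEN the eighteen rungs in cluster currency as hypotheses (pure classes: TOP / MID / THREE-SCALE;
mixed classes: the face rules TOP / MID / repaired THREE-SCALE) — W1 g14 #72–#76 prove them.  The member dictionary (this seat's
`…ThreePairChainDictionary`) converts «some member of `w` of degree `d` is alive» into the canonical slots the rungs speak about.

Pure finite bookkeeping over an abstract limit Gram table `Γ` and its alive relation; def-free; nothing here bears on `DoorA26`,
`MatrixDescartes` (stmt-ValiantsHypothesis-18050) or `VP ≠ VNP`.  `--supports stmt-ValiantsHypothesis-19979 --as helper`.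
-/

-- `Summit.ValiantsHypothesis.ValiantsHypothesis.…` repeats a component by the D-0017 layout
-- (single-conjunct summit), which the `dupNamespace` linter flags; the name is mandated.
set_option linter.dupNamespace false

namespace Summit.ValiantsHypothesis.ValiantsHypothesis.Theorems.LacunarySymmetroidMatrixDescartes.WallBubbling

open Finset
open Bubbling (polar)
open scoped BigOperators

/-- **Slot splitting for the six classes at a value-generic three-Weyl-pair point** (W2's `hsplit`: `Σ_c d_c(w) ≤ 2` for every class value
`w = δ0 p₀ + δ0 q₀`), modulo the eighteen rungs in cluster currency. [this work] -/
theorem threePair_hsplit (δ0 : Fin 6 → ℝ) (h50 : δ0 5 = δ0 0) (h41 : δ0 4 = δ0 1) (h32 : δ0 3 = δ0 2)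
    (hvg : ∀ a b c e : Fin 3, δ0 a.castSucc.castSucc.castSucc + δ0 b.castSucc.castSucc.castSucc
        = δ0 c.castSucc.castSucc.castSucc + δ0 e.castSucc.castSucc.castSucc → (a = c ∧ b = e) ∨ (a = e ∧ b = c))
    {C : ℕ} (Γ : Fin C → Fin 6 → Fin 6 → ℝ) (W : Fin C → Fin 6 → Matrix (Fin 2) (Fin 2) ℝ)
    (hal : ∀ c p q, polar (W c p) (W c q) ≠ 0 ↔ Γ c p q ≠ 0) (hΓsymm : ∀ c a b, Γ c a b = Γ c b a)
    (Rtop₀₅ : ∀ c c' : Fin C, c < c' → Γ c 5 5 ≠ 0 → Γ c' 5 5 = 0 ∧ Γ c' 0 5 = 0)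
    (Rmid₀₅ : ∀ c c' : Fin C, c < c' → Γ c 0 5 ≠ 0 → Γ c' 5 5 = 0)
    (Rthree₀₅ : ∀ c₁ c₂ c₃ : Fin C, c₁ < c₂ → c₂ < c₃ → Γ c₁ 0 5 ≠ 0 → Γ c₂ 0 5 ≠ 0 → Γ c₃ 0 5 ≠ 0 → False)
    (Rtop₁₄ : ∀ c c' : Fin C, c < c' → Γ c 4 4 ≠ 0 → Γ c' 4 4 = 0 ∧ Γ c' 1 4 = 0)
    (Rmid₁₄ : ∀ c c' : Fin C, c < c' → Γ c 1 4 ≠ 0 → Γ c' 4 4 = 0)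
    (Rthree₁₄ : ∀ c₁ c₂ c₃ : Fin C, c₁ < c₂ → c₂ < c₃ → Γ c₁ 1 4 ≠ 0 → Γ c₂ 1 4 ≠ 0 → Γ c₃ 1 4 ≠ 0 → False)
    (Rtop₂₃ : ∀ c c' : Fin C, c < c' → Γ c 3 3 ≠ 0 → Γ c' 3 3 = 0 ∧ Γ c' 2 3 = 0)
    (Rmid₂₃ : ∀ c c' : Fin C, c < c' → Γ c 2 3 ≠ 0 → Γ c' 3 3 = 0)
    (Rthree₂₃ : ∀ c₁ c₂ c₃ : Fin C, c₁ < c₂ → c₂ < c₃ → Γ c₁ 2 3 ≠ 0 → Γ c₂ 2 3 ≠ 0 → Γ c₃ 2 3 ≠ 0 → False)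
    (Mtop₀₁ : ∀ c c' : Fin C, c < c' → Γ c 5 4 ≠ 0 → Γ c' 5 4 = 0 ∧ Γ c' 0 4 = 0 ∧ Γ c' 5 1 = 0)
    (Mmid₀₁ : ∀ c c' : Fin C, c < c' → (Γ c 0 4 ≠ 0 ∨ Γ c 5 1 ≠ 0) → Γ c' 5 4 = 0)
    (Mthree₀₁ : ∀ c₁ c₂ c₃ : Fin C, c₁ < c₂ → c₂ < c₃ → (Γ c₁ 0 4 ≠ 0 ∨ Γ c₁ 5 1 ≠ 0) → (Γ c₂ 0 4 ≠ 0 ∨ Γ c₂ 5 1 ≠ 0) →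
      (Γ c₃ 0 4 ≠ 0 ∨ Γ c₃ 5 1 ≠ 0) → False)
    (Mtop₀₂ : ∀ c c' : Fin C, c < c' → Γ c 5 3 ≠ 0 → Γ c' 5 3 = 0 ∧ Γ c' 0 3 = 0 ∧ Γ c' 5 2 = 0)
    (Mmid₀₂ : ∀ c c' : Fin C, c < c' → (Γ c 0 3 ≠ 0 ∨ Γ c 5 2 ≠ 0) → Γ c' 5 3 = 0)
    (Mthree₀₂ : ∀ c₁ c₂ c₃ : Fin C, c₁ < c₂ → c₂ < c₃ → (Γ c₁ 0 3 ≠ 0 ∨ Γ c₁ 5 2 ≠ 0) → (Γ c₂ 0 3 ≠ 0 ∨ Γ c₂ 5 2 ≠ 0) →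
      (Γ c₃ 0 3 ≠ 0 ∨ Γ c₃ 5 2 ≠ 0) → False)
    (Mtop₁₂ : ∀ c c' : Fin C, c < c' → Γ c 4 3 ≠ 0 → Γ c' 4 3 = 0 ∧ Γ c' 1 3 = 0 ∧ Γ c' 4 2 = 0)
    (Mmid₁₂ : ∀ c c' : Fin C, c < c' → (Γ c 1 3 ≠ 0 ∨ Γ c 4 2 ≠ 0) → Γ c' 4 3 = 0)
    (Mthree₁₂ : ∀ c₁ c₂ c₃ : Fin C, c₁ < c₂ → c₂ < c₃ → (Γ c₁ 1 3 ≠ 0 ∨ Γ c₁ 4 2 ≠ 0) → (Γ c₂ 1 3 ≠ 0 ∨ Γ c₂ 4 2 ≠ 0) →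
      (Γ c₃ 1 3 ≠ 0 ∨ Γ c₃ 4 2 ≠ 0) → False) :
    ∀ p₀ q₀ : Fin 6, ∀ w : ℝ, w = δ0 p₀ + δ0 q₀ →
      (∑ c : Fin C, (if w ∈ ((univ : Finset (Fin 6 × Fin 6)).image (fun pq => δ0 pq.1 + δ0 pq.2)).filter (fun w => (∃ p q : Fin 6, δ0 p + δ0 q = w ∧ polar (W c p) (W c q) ≠ 0))
        then (if (∃ p q : Fin 6, δ0 p + δ0 q = w ∧ polar (W c p) (W c q) ≠ 0 ∧ (if p = 5 then 1 else if p = 4 then 1 else if p = 3 then 1 else 0) + (if q = 5 then 1 else if q = 4 then 1 else if q = 3 then 1 else 0) = 2) then 2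
          else if (∃ p q : Fin 6, δ0 p + δ0 q = w ∧ polar (W c p) (W c q) ≠ 0 ∧ (if p = 5 then 1 else if p = 4 then 1 else if p = 3 then 1 else 0) + (if q = 5 then 1 else if q = 4 then 1 else if q = 3 then 1 else 0) = 1) then 1 else 0) else 0)) ≤ 2 := by
  classical
  set V : Finset ℝ := ((univ : Finset (Fin 6 × Fin 6)).image (fun pq => δ0 pq.1 + δ0 pq.2)) with hV
  -- reading the summand: `= 2` / `= 1` give the corresponding existential
  have hS2 : ∀ (c : Fin C) (w : ℝ), (if w ∈ V.filter (fun w => (∃ p q : Fin 6, δ0 p + δ0 q = w ∧ polar (W c p) (W c q) ≠ 0))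
        then (if (∃ p q : Fin 6, δ0 p + δ0 q = w ∧ polar (W c p) (W c q) ≠ 0 ∧ (if p = 5 then 1 else if p = 4 then 1 else if p = 3 then 1 else 0) + (if q = 5 then 1 else if q = 4 then 1 else if q = 3 then 1 else 0) = 2) then 2
          else if (∃ p q : Fin 6, δ0 p + δ0 q = w ∧ polar (W c p) (W c q) ≠ 0 ∧ (if p = 5 then 1 else if p = 4 then 1 else if p = 3 then 1 else 0) + (if q = 5 then 1 else if q = 4 then 1 else if q = 3 then 1 else 0) = 1) then 1 else 0) else 0) = 2 →
      ∃ p q : Fin 6, δ0 p + δ0 q = w ∧ polar (W c p) (W c q) ≠ 0 ∧ (if p = 5 then 1 else if p = 4 then 1 else if p = 3 then 1 else 0) + (if q = 5 then 1 else if q = 4 then 1 else if q = 3 then 1 else 0) = 2 := by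
    intro c w h
    by_contra hn
    by_cases hmem : w ∈ V.filter (fun w => (∃ p q : Fin 6, δ0 p + δ0 q = w ∧ polar (W c p) (W c q) ≠ 0))
    · rw [if_pos hmem, if_neg hn] at h; split_ifs at h; all_goals omega
    · rw [if_neg hmem] at h; omega
  have hS1' : ∀ (c : Fin C) (w : ℝ), (if w ∈ V.filter (fun w => (∃ p q : Fin 6, δ0 p + δ0 q = w ∧ polar (W c p) (W c q) ≠ 0))
        then (if (∃ p q : Fin 6, δ0 p + δ0 q = w ∧ polar (W c p) (W c q) ≠ 0 ∧ (if p = 5 then 1 else if p = 4 then 1 else if p = 3 then 1 else 0) + (if q = 5 then 1 else if q = 4 then 1 else if q = 3 then 1 else 0) = 2) then 2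
          else if (∃ p q : Fin 6, δ0 p + δ0 q = w ∧ polar (W c p) (W c q) ≠ 0 ∧ (if p = 5 then 1 else if p = 4 then 1 else if p = 3 then 1 else 0) + (if q = 5 then 1 else if q = 4 then 1 else if q = 3 then 1 else 0) = 1) then 1 else 0) else 0) = 1 →
      ∃ p q : Fin 6, δ0 p + δ0 q = w ∧ polar (W c p) (W c q) ≠ 0 ∧ (if p = 5 then 1 else if p = 4 then 1 else if p = 3 then 1 else 0) + (if q = 5 then 1 else if q = 4 then 1 else if q = 3 then 1 else 0) = 1 := by
    intro c w h
    by_contra hn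
    by_cases hmem : w ∈ V.filter (fun w => (∃ p q : Fin 6, δ0 p + δ0 q = w ∧ polar (W c p) (W c q) ≠ 0))
    · rw [if_pos hmem] at h
      by_cases h2 : ∃ p q : Fin 6, δ0 p + δ0 q = w ∧ polar (W c p) (W c q) ≠ 0 ∧ (if p = 5 then 1 else if p = 4 then 1 else if p = 3 then 1 else 0) + (if q = 5 then 1 else if q = 4 then 1 else if q = 3 then 1 else 0) = 2
      · rw [if_pos h2] at h; omega
      · rw [if_neg h2, if_neg hn] at h; omega
    · rw [if_neg hmem] at h; omega
  have hSle2 : ∀ (c : Fin C) (w : ℝ), (if w ∈ V.filter (fun w => (∃ p q : Fin 6, δ0 p + δ0 q = w ∧ polar (W c p) (W c q) ≠ 0))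
        then (if (∃ p q : Fin 6, δ0 p + δ0 q = w ∧ polar (W c p) (W c q) ≠ 0 ∧ (if p = 5 then 1 else if p = 4 then 1 else if p = 3 then 1 else 0) + (if q = 5 then 1 else if q = 4 then 1 else if q = 3 then 1 else 0) = 2) then 2
          else if (∃ p q : Fin 6, δ0 p + δ0 q = w ∧ polar (W c p) (W c q) ≠ 0 ∧ (if p = 5 then 1 else if p = 4 then 1 else if p = 3 then 1 else 0) + (if q = 5 then 1 else if q = 4 then 1 else if q = 3 then 1 else 0) = 1) then 1 else 0) else 0) ≤ 2 := by
    intro c w; split_ifs <;> omega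
  have hS0 : ∀ (c : Fin C) (w : ℝ),
      (¬ ∃ p q : Fin 6, δ0 p + δ0 q = w ∧ polar (W c p) (W c q) ≠ 0 ∧ (if p = 5 then 1 else if p = 4 then 1 else if p = 3 then 1 else 0) + (if q = 5 then 1 else if q = 4 then 1 else if q = 3 then 1 else 0) = 2) →
      (¬ ∃ p q : Fin 6, δ0 p + δ0 q = w ∧ polar (W c p) (W c q) ≠ 0 ∧ (if p = 5 then 1 else if p = 4 then 1 else if p = 3 then 1 else 0) + (if q = 5 then 1 else if q = 4 then 1 else if q = 3 then 1 else 0) = 1) →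
      (if w ∈ V.filter (fun w => (∃ p q : Fin 6, δ0 p + δ0 q = w ∧ polar (W c p) (W c q) ≠ 0))
        then (if (∃ p q : Fin 6, δ0 p + δ0 q = w ∧ polar (W c p) (W c q) ≠ 0 ∧ (if p = 5 then 1 else if p = 4 then 1 else if p = 3 then 1 else 0) + (if q = 5 then 1 else if q = 4 then 1 else if q = 3 then 1 else 0) = 2) then 2
          else if (∃ p q : Fin 6, δ0 p + δ0 q = w ∧ polar (W c p) (W c q) ≠ 0 ∧ (if p = 5 then 1 else if p = 4 then 1 else if p = 3 then 1 else 0) + (if q = 5 then 1 else if q = 4 then 1 else if q = 3 then 1 else 0) = 1) then 1 else 0) else 0) = 0 := by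
    intro c w h2 h1
    rw [if_neg h2, if_neg h1, ite_self]
  -- the member dictionary, instantiated at the alive relation of cluster `c`
  have hAs : ∀ (c : Fin C) (p q : Fin 6), Γ c p q ≠ 0 → Γ c q p ≠ 0 := fun c p q h => by rwa [hΓsymm]
  have dP0_2 : ∀ (c : Fin C) (p q : Fin 6), δ0 p + δ0 q = δ0 0 + δ0 0 → polar (W c p) (W c q) ≠ 0 →
      (if p = 5 then 1 else if p = 4 then 1 else if p = 3 then 1 else 0) + (if q = 5 then 1 else if q = 4 then 1 else if q = 3 then 1 else 0) = 2 → Γ c 5 5 ≠ 0 :=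
    fun c p q h1 h2 h3 => threePair_dict_P0_2 δ0 h50 h41 h32 hvg (fun p q => Γ c p q ≠ 0) (hAs c) p q h1 ((hal c p q).mp h2) h3
  have dP0_1 : ∀ (c : Fin C) (p q : Fin 6), δ0 p + δ0 q = δ0 0 + δ0 0 → polar (W c p) (W c q) ≠ 0 →
      (if p = 5 then 1 else if p = 4 then 1 else if p = 3 then 1 else 0) + (if q = 5 then 1 else if q = 4 then 1 else if q = 3 then 1 else 0) = 1 → Γ c 0 5 ≠ 0 :=
    fun c p q h1 h2 h3 => threePair_dict_P0_1 δ0 h50 h41 h32 hvg (fun p q => Γ c p q ≠ 0) (hAs c) p q h1 ((hal c p q).mp h2) h3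
  have dP1_2 : ∀ (c : Fin C) (p q : Fin 6), δ0 p + δ0 q = δ0 1 + δ0 1 → polar (W c p) (W c q) ≠ 0 →
      (if p = 5 then 1 else if p = 4 then 1 else if p = 3 then 1 else 0) + (if q = 5 then 1 else if q = 4 then 1 else if q = 3 then 1 else 0) = 2 → Γ c 4 4 ≠ 0 :=
    fun c p q h1 h2 h3 => threePair_dict_P1_2 δ0 h50 h41 h32 hvg (fun p q => Γ c p q ≠ 0) (hAs c) p q h1 ((hal c p q).mp h2) h3
  have dP1_1 : ∀ (c : Fin C) (p q : Fin 6), δ0 p + δ0 q = δ0 1 + δ0 1 → polar (W c p) (W c q) ≠ 0 →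
      (if p = 5 then 1 else if p = 4 then 1 else if p = 3 then 1 else 0) + (if q = 5 then 1 else if q = 4 then 1 else if q = 3 then 1 else 0) = 1 → Γ c 1 4 ≠ 0 :=
    fun c p q h1 h2 h3 => threePair_dict_P1_1 δ0 h50 h41 h32 hvg (fun p q => Γ c p q ≠ 0) (hAs c) p q h1 ((hal c p q).mp h2) h3
  have dP2_2 : ∀ (c : Fin C) (p q : Fin 6), δ0 p + δ0 q = δ0 2 + δ0 2 → polar (W c p) (W c q) ≠ 0 →
      (if p = 5 then 1 else if p = 4 then 1 else if p = 3 then 1 else 0) + (if q = 5 then 1 else if q = 4 then 1 else if q = 3 then 1 else 0) = 2 → Γ c 3 3 ≠ 0 :=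
    fun c p q h1 h2 h3 => threePair_dict_P2_2 δ0 h50 h41 h32 hvg (fun p q => Γ c p q ≠ 0) (hAs c) p q h1 ((hal c p q).mp h2) h3
  have dP2_1 : ∀ (c : Fin C) (p q : Fin 6), δ0 p + δ0 q = δ0 2 + δ0 2 → polar (W c p) (W c q) ≠ 0 →
      (if p = 5 then 1 else if p = 4 then 1 else if p = 3 then 1 else 0) + (if q = 5 then 1 else if q = 4 then 1 else if q = 3 then 1 else 0) = 1 → Γ c 2 3 ≠ 0 :=
    fun c p q h1 h2 h3 => threePair_dict_P2_1 δ0 h50 h41 h32 hvg (fun p q => Γ c p q ≠ 0) (hAs c) p q h1 ((hal c p q).mp h2) h3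
  have dM01_2 : ∀ (c : Fin C) (p q : Fin 6), δ0 p + δ0 q = δ0 0 + δ0 1 → polar (W c p) (W c q) ≠ 0 →
      (if p = 5 then 1 else if p = 4 then 1 else if p = 3 then 1 else 0) + (if q = 5 then 1 else if q = 4 then 1 else if q = 3 then 1 else 0) = 2 → Γ c 5 4 ≠ 0 :=
    fun c p q h1 h2 h3 => threePair_dict_M01_2 δ0 h50 h41 h32 hvg (fun p q => Γ c p q ≠ 0) (hAs c) p q h1 ((hal c p q).mp h2) h3
  have dM01_1 : ∀ (c : Fin C) (p q : Fin 6), δ0 p + δ0 q = δ0 0 + δ0 1 → polar (W c p) (W c q) ≠ 0 →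
      (if p = 5 then 1 else if p = 4 then 1 else if p = 3 then 1 else 0) + (if q = 5 then 1 else if q = 4 then 1 else if q = 3 then 1 else 0) = 1 → Γ c 0 4 ≠ 0 ∨ Γ c 5 1 ≠ 0 :=
    fun c p q h1 h2 h3 => threePair_dict_M01_1 δ0 h50 h41 h32 hvg (fun p q => Γ c p q ≠ 0) (hAs c) p q h1 ((hal c p q).mp h2) h3
  have dM02_2 : ∀ (c : Fin C) (p q : Fin 6), δ0 p + δ0 q = δ0 0 + δ0 2 → polar (W c p) (W c q) ≠ 0 →
      (if p = 5 then 1 else if p = 4 then 1 else if p = 3 then 1 else 0) + (if q = 5 then 1 else if q = 4 then 1 else if q = 3 then 1 else 0) = 2 → Γ c 5 3 ≠ 0 :=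
    fun c p q h1 h2 h3 => threePair_dict_M02_2 δ0 h50 h41 h32 hvg (fun p q => Γ c p q ≠ 0) (hAs c) p q h1 ((hal c p q).mp h2) h3
  have dM02_1 : ∀ (c : Fin C) (p q : Fin 6), δ0 p + δ0 q = δ0 0 + δ0 2 → polar (W c p) (W c q) ≠ 0 →
      (if p = 5 then 1 else if p = 4 then 1 else if p = 3 then 1 else 0) + (if q = 5 then 1 else if q = 4 then 1 else if q = 3 then 1 else 0) = 1 → Γ c 0 3 ≠ 0 ∨ Γ c 5 2 ≠ 0 :=
    fun c p q h1 h2 h3 => threePair_dict_M02_1 δ0 h50 h41 h32 hvg (fun p q => Γ c p q ≠ 0) (hAs c) p q h1 ((hal c p q).mp h2) h3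
  have dM12_2 : ∀ (c : Fin C) (p q : Fin 6), δ0 p + δ0 q = δ0 1 + δ0 2 → polar (W c p) (W c q) ≠ 0 →
      (if p = 5 then 1 else if p = 4 then 1 else if p = 3 then 1 else 0) + (if q = 5 then 1 else if q = 4 then 1 else if q = 3 then 1 else 0) = 2 → Γ c 4 3 ≠ 0 :=
    fun c p q h1 h2 h3 => threePair_dict_M12_2 δ0 h50 h41 h32 hvg (fun p q => Γ c p q ≠ 0) (hAs c) p q h1 ((hal c p q).mp h2) h3
  have dM12_1 : ∀ (c : Fin C) (p q : Fin 6), δ0 p + δ0 q = δ0 1 + δ0 2 → polar (W c p) (W c q) ≠ 0 →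
      (if p = 5 then 1 else if p = 4 then 1 else if p = 3 then 1 else 0) + (if q = 5 then 1 else if q = 4 then 1 else if q = 3 then 1 else 0) = 1 → Γ c 1 3 ≠ 0 ∨ Γ c 4 2 ≠ 0 :=
    fun c p q h1 h2 h3 => threePair_dict_M12_1 δ0 h50 h41 h32 hvg (fun p q => Γ c p q ≠ 0) (hAs c) p q h1 ((hal c p q).mp h2) h3
  intro p₀ q₀ w hw0
  rcases threePair_values δ0 h50 h41 h32 p₀ q₀ with hv | hv | hv | hv | hv | hv <;> (have hw := hw0.trans hv; clear hw0 hv)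
  · -- the pure class `2δ₀`
    subst hw
    refine sum_le_two_of_rules _ (fun c => hSle2 c _) ?_ ?_
    · intro c c' hcc' hfc
      obtain ⟨p, q, hpq, hpol, hdg⟩ := hS2 c _ hfc
      have hjj : Γ c 5 5 ≠ 0 := dP0_2 c p q hpq hpol hdg
      have hdead : Γ c' 5 5 = 0 ∧ Γ c' 0 5 = 0 := by
        rcases lt_or_gt_of_ne hcc' with hlt | hgt
        · exact Rtop₀₅ c c' hlt hjj
        · constructor
          · by_contra h'; exact hjj (Rtop₀₅ c' c hgt h').1
          · by_contra h'; exact hjj (Rmid₀₅ c' c hgt h')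
      refine hS0 c' _ ?_ ?_
      · rintro ⟨p', q', hpq', hpol', hdg'⟩; exact dP0_2 c' p' q' hpq' hpol' hdg' hdead.1
      · rintro ⟨p', q', hpq', hpol', hdg'⟩; exact dP0_1 c' p' q' hpq' hpol' hdg' hdead.2
    · intro c₁ c₂ c₃ h12 h23 hf1 hf2 hf3
      obtain ⟨p₁, q₁, a1, b1, d1⟩ := hS1' c₁ _ hf1
      obtain ⟨p₂, q₂, a2, b2, d2⟩ := hS1' c₂ _ hf2
      obtain ⟨p₃, q₃, a3, b3, d3⟩ := hS1' c₃ _ hf3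
      exact Rthree₀₅ c₁ c₂ c₃ h12 h23 (dP0_1 c₁ p₁ q₁ a1 b1 d1) (dP0_1 c₂ p₂ q₂ a2 b2 d2) (dP0_1 c₃ p₃ q₃ a3 b3 d3)
  · -- the pure class `2δ₁`
    subst hw
    refine sum_le_two_of_rules _ (fun c => hSle2 c _) ?_ ?_
    · intro c c' hcc' hfc
      obtain ⟨p, q, hpq, hpol, hdg⟩ := hS2 c _ hfc
      have hjj : Γ c 4 4 ≠ 0 := dP1_2 c p q hpq hpol hdg
      have hdead : Γ c' 4 4 = 0 ∧ Γ c' 1 4 = 0 := by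
        rcases lt_or_gt_of_ne hcc' with hlt | hgt
        · exact Rtop₁₄ c c' hlt hjj
        · constructor
          · by_contra h'; exact hjj (Rtop₁₄ c' c hgt h').1
          · by_contra h'; exact hjj (Rmid₁₄ c' c hgt h')
      refine hS0 c' _ ?_ ?_
      · rintro ⟨p', q', hpq', hpol', hdg'⟩; exact dP1_2 c' p' q' hpq' hpol' hdg' hdead.1
      · rintro ⟨p', q', hpq', hpol', hdg'⟩; exact dP1_1 c' p' q' hpq' hpol' hdg' hdead.2
    · intro c₁ c₂ c₃ h12 h23 hf1 hf2 hf3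
      obtain ⟨p₁, q₁, a1, b1, d1⟩ := hS1' c₁ _ hf1
      obtain ⟨p₂, q₂, a2, b2, d2⟩ := hS1' c₂ _ hf2
      obtain ⟨p₃, q₃, a3, b3, d3⟩ := hS1' c₃ _ hf3
      exact Rthree₁₄ c₁ c₂ c₃ h12 h23 (dP1_1 c₁ p₁ q₁ a1 b1 d1) (dP1_1 c₂ p₂ q₂ a2 b2 d2) (dP1_1 c₃ p₃ q₃ a3 b3 d3)
  · -- the pure class `2δ₂`
    subst hw
    refine sum_le_two_of_rules _ (fun c => hSle2 c _) ?_ ?_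
    · intro c c' hcc' hfc
      obtain ⟨p, q, hpq, hpol, hdg⟩ := hS2 c _ hfc
      have hjj : Γ c 3 3 ≠ 0 := dP2_2 c p q hpq hpol hdg
      have hdead : Γ c' 3 3 = 0 ∧ Γ c' 2 3 = 0 := by
        rcases lt_or_gt_of_ne hcc' with hlt | hgt
        · exact Rtop₂₃ c c' hlt hjj
        · constructor
          · by_contra h'; exact hjj (Rtop₂₃ c' c hgt h').1
          · by_contra h'; exact hjj (Rmid₂₃ c' c hgt h')
      refine hS0 c' _ ?_ ?_
      · rintro ⟨p', q', hpq', hpol', hdg'⟩; exact dP2_2 c' p' q' hpq' hpol' hdg' hdead.1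
      · rintro ⟨p', q', hpq', hpol', hdg'⟩; exact dP2_1 c' p' q' hpq' hpol' hdg' hdead.2
    · intro c₁ c₂ c₃ h12 h23 hf1 hf2 hf3
      obtain ⟨p₁, q₁, a1, b1, d1⟩ := hS1' c₁ _ hf1
      obtain ⟨p₂, q₂, a2, b2, d2⟩ := hS1' c₂ _ hf2
      obtain ⟨p₃, q₃, a3, b3, d3⟩ := hS1' c₃ _ hf3
      exact Rthree₂₃ c₁ c₂ c₃ h12 h23 (dP2_1 c₁ p₁ q₁ a1 b1 d1) (dP2_1 c₂ p₂ q₂ a2 b2 d2) (dP2_1 c₃ p₃ q₃ a3 b3 d3)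
  · -- the mixed class `δ₀+δ₁`
    subst hw
    refine sum_le_two_of_rules _ (fun c => hSle2 c _) ?_ ?_
    · intro c c' hcc' hfc
      obtain ⟨p, q, hpq, hpol, hdg⟩ := hS2 c _ hfc
      have hjj : Γ c 5 4 ≠ 0 := dM01_2 c p q hpq hpol hdg
      have hdead : Γ c' 5 4 = 0 ∧ Γ c' 0 4 = 0 ∧ Γ c' 5 1 = 0 := by
        rcases lt_or_gt_of_ne hcc' with hlt | hgt
        · exact Mtop₀₁ c c' hlt hjj
        · refine ⟨?_, ?_, ?_⟩
          · by_contra h'; exact hjj (Mtop₀₁ c' c hgt h').1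
          · by_contra h'; exact hjj (Mmid₀₁ c' c hgt (Or.inl h'))
          · by_contra h'; exact hjj (Mmid₀₁ c' c hgt (Or.inr h'))
      refine hS0 c' _ ?_ ?_
      · rintro ⟨p', q', hpq', hpol', hdg'⟩; exact dM01_2 c' p' q' hpq' hpol' hdg' hdead.1
      · rintro ⟨p', q', hpq', hpol', hdg'⟩
        rcases dM01_1 c' p' q' hpq' hpol' hdg' with h | h
        · exact h hdead.2.1
        · exact h hdead.2.2
    · intro c₁ c₂ c₃ h12 h23 hf1 hf2 hf3
      obtain ⟨p₁, q₁, a1, b1, d1⟩ := hS1' c₁ _ hf1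
      obtain ⟨p₂, q₂, a2, b2, d2⟩ := hS1' c₂ _ hf2
      obtain ⟨p₃, q₃, a3, b3, d3⟩ := hS1' c₃ _ hf3
      exact Mthree₀₁ c₁ c₂ c₃ h12 h23 (dM01_1 c₁ p₁ q₁ a1 b1 d1) (dM01_1 c₂ p₂ q₂ a2 b2 d2) (dM01_1 c₃ p₃ q₃ a3 b3 d3)
  · -- the mixed class `δ₀+δ₂`
    subst hw
    refine sum_le_two_of_rules _ (fun c => hSle2 c _) ?_ ?_
    · intro c c' hcc' hfc
      obtain ⟨p, q, hpq, hpol, hdg⟩ := hS2 c _ hfc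
      have hjj : Γ c 5 3 ≠ 0 := dM02_2 c p q hpq hpol hdg
      have hdead : Γ c' 5 3 = 0 ∧ Γ c' 0 3 = 0 ∧ Γ c' 5 2 = 0 := by
        rcases lt_or_gt_of_ne hcc' with hlt | hgt
        · exact Mtop₀₂ c c' hlt hjj
        · refine ⟨?_, ?_, ?_⟩
          · by_contra h'; exact hjj (Mtop₀₂ c' c hgt h').1
          · by_contra h'; exact hjj (Mmid₀₂ c' c hgt (Or.inl h'))
          · by_contra h'; exact hjj (Mmid₀₂ c' c hgt (Or.inr h'))
      refine hS0 c' _ ?_ ?_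
      · rintro ⟨p', q', hpq', hpol', hdg'⟩; exact dM02_2 c' p' q' hpq' hpol' hdg' hdead.1
      · rintro ⟨p', q', hpq', hpol', hdg'⟩
        rcases dM02_1 c' p' q' hpq' hpol' hdg' with h | h
        · exact h hdead.2.1
        · exact h hdead.2.2
    · intro c₁ c₂ c₃ h12 h23 hf1 hf2 hf3
      obtain ⟨p₁, q₁, a1, b1, d1⟩ := hS1' c₁ _ hf1
      obtain ⟨p₂, q₂, a2, b2, d2⟩ := hS1' c₂ _ hf2
      obtain ⟨p₃, q₃, a3, b3, d3⟩ := hS1' c₃ _ hf3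
      exact Mthree₀₂ c₁ c₂ c₃ h12 h23 (dM02_1 c₁ p₁ q₁ a1 b1 d1) (dM02_1 c₂ p₂ q₂ a2 b2 d2) (dM02_1 c₃ p₃ q₃ a3 b3 d3)
  · -- the mixed class `δ₁+δ₂`
    subst hw
    refine sum_le_two_of_rules _ (fun c => hSle2 c _) ?_ ?_
    · intro c c' hcc' hfc
      obtain ⟨p, q, hpq, hpol, hdg⟩ := hS2 c _ hfc
      have hjj : Γ c 4 3 ≠ 0 := dM12_2 c p q hpq hpol hdg
      have hdead : Γ c' 4 3 = 0 ∧ Γ c' 1 3 = 0 ∧ Γ c' 4 2 = 0 := by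
        rcases lt_or_gt_of_ne hcc' with hlt | hgt
        · exact Mtop₁₂ c c' hlt hjj
        · refine ⟨?_, ?_, ?_⟩
          · by_contra h'; exact hjj (Mtop₁₂ c' c hgt h').1
          · by_contra h'; exact hjj (Mmid₁₂ c' c hgt (Or.inl h'))
          · by_contra h'; exact hjj (Mmid₁₂ c' c hgt (Or.inr h'))
      refine hS0 c' _ ?_ ?_
      · rintro ⟨p', q', hpq', hpol', hdg'⟩; exact dM12_2 c' p' q' hpq' hpol' hdg' hdead.1
      · rintro ⟨p', q', hpq', hpol', hdg'⟩
        rcases dM12_1 c' p' q' hpq' hpol' hdg' with h | h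
        · exact h hdead.2.1
        · exact h hdead.2.2
    · intro c₁ c₂ c₃ h12 h23 hf1 hf2 hf3
      obtain ⟨p₁, q₁, a1, b1, d1⟩ := hS1' c₁ _ hf1
      obtain ⟨p₂, q₂, a2, b2, d2⟩ := hS1' c₂ _ hf2
      obtain ⟨p₃, q₃, a3, b3, d3⟩ := hS1' c₃ _ hf3
      exact Mthree₁₂ c₁ c₂ c₃ h12 h23 (dM12_1 c₁ p₁ q₁ a1 b1 d1) (dM12_1 c₂ p₂ q₂ a2 b2 d2) (dM12_1 c₃ p₃ q₃ a3 b3 d3)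

end Summit.ValiantsHypothesis.ValiantsHypothesis.Theorems.LacunarySymmetroidMatrixDescartes.WallBubbling
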